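import Summits.KontsevichZagierPeriods.KontsevichZagierPeriods.Theses.RootDecompRationalCubeDichotomy
import Summits.KontsevichZagierPeriods.KontsevichZagierPeriods.Theorems.SoloInformedPiDisc
import Summits.KontsevichZagierPeriods.KontsevichZagierPeriods.Theorems.RootDecompRationalCubeDichotomySectorMerge
import Summits.KontsevichZagierPeriods.KontsevichZagierPeriods.Theorems.RootDecompRationalCubeDichotomyPiTimesSector
import Summits.KontsevichZagierPeriods.KontsevichZagierPeriods.Theorems.RootDecompRationalCubeDichotomyRationalCubePiKernelGlue
import Literature.NumberTheory.Transcendental.KZCubeRationalMoves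
import Literature.NumberTheory.Transcendental.KZProductIdeal
import Literature.NumberTheory.Transcendental.KZLogCalculusProofs
import Literature.NumberTheory.Transcendental.KZSemialgebraicComplex

/-!
# Route RootDecompRationalCubeDichotomy — rung of item 24903, part 1/3: the rational closed-cube sector,
# `[π]` on it, and the fibred substitution move `of_sub_of_mem_relations_of_fibreMap`

Support for item stmt-KontsevichZagierPeriods-24903 (`PiRationalisation`); closes no item. Part 1 of the
Theorems-split of the decomp-kz lens-2 gen-4 rung file (`run/shared/lean/pub/decomp-kz/decomp-kz-lens-2/g4/
PiRationalisationSqrtOne24903.lean`, 903 lines, critic-certified 2026-08-30T04:35:52Z); parts 2/3 =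
`…PiRationalisationSqrtDefs.lean` (doubling / Möbius instances, the two rung statements) and 3/3 =
`…PiRationalisationSqrt.lean` (the rungs proved and certified literal special cases of the item).
Contents here: `[π]`-iterates on the rational closed-cube sector `ratCubeSet` (reusing the LANDED Theorems files
`…SectorMerge` / `…PiTimesSector` / `…RationalCubePiKernelGlue`: `piRep_mul_mem_sup_of_mem_ratCubeSet`, `piIter_mem_sup`), and the NEW general
move `of_sub_of_mem_relations_of_fibreMap` — change of variables along the last coordinate by a fibred `C¹`
semialgebraic substitution with positive `t`-derivative (generalises `KZ.of_sub_of_mem_relations_of_affine`;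
Jacobian via `LinearMap.det_of_snoc_init`). [Kontsevich–Zagier 2001, §1.2, rule 2)] Standard axioms, 0 sorry.
-/

namespace Summit.KontsevichZagierPeriods.RootDecompRationalCubeDichotomy.Rung24903

open MeasureTheory Set MvPolynomial
open Literature.NumberTheory.Transcendental Literature.NumberTheory.Transcendental.KZ
open Literature.ModelTheory.ExponentialFields (IsSemialgebraic)
open Summit.KontsevichZagierPeriods.KontsevichZagierPeriods.Theses.RootDecompRationalCubeDichotomy
  (PiRationalisation PiTimesSector)

/-! ### The rational closed-cube sector and `[π]` on it (content of item 26388, local form) -/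

/-- `[π]·y ∈ relations ⊔ ⟨sector⟩` for every sector generator `y` — the CONTENT of item 26388
`PiTimesSector`, proved here for the local literal `ratCubeSet` (the sibling Theorems file
`RootDecompRationalCubeDichotomyPiTimesSector.lean` is the one that closes item 26388 by name; this file
does not claim it). [this route] -/
theorem piRep_mul_mem_sup_of_mem_ratCubeSet {y : FormalRep} (hy : y ∈ ratCubeSet) :
    of piRep * y ∈ relations ⊔ AddSubgroup.closure ratCubeSet := by
  obtain ⟨ρ, hρ, s, hs, hρs⟩ := AddSubgroup.mem_sup.mp piRep_mem_sup
  rw [← hρs, add_mul]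
  exact add_mem (AddSubgroup.mem_sup_left (mul_mem_relations_right_holds ρ y hρ))
    (mul_mem_sup_of_mem_closure hs hy)

/-- `eval` of the `K`-fold `[π]`-multiple. [folklore] -/
theorem eval_piIter (K : ℕ) (x : FormalRep) :
    eval ((fun y : FormalRep => of piRep * y)^[K] x) = Real.pi ^ K * eval x := by
  induction K with
  | zero => simp
  | succ K ih => rw [Function.iterate_succ_apply', eval_piRep_mul, ih, pow_succ]; ring

/-- `[π]` maps the subgroup generated by the sector into `relations ⊔ ⟨sector⟩`. [this route] -/
theorem piRep_mul_mem_sup_of_mem_closure (hπ : PiTimesSector) {z : FormalRep}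
    (hz : z ∈ AddSubgroup.closure ratCubeSet) :
    of piRep * z ∈ relations ⊔ AddSubgroup.closure ratCubeSet := by
  induction hz using AddSubgroup.closure_induction with
  | mem x hx => exact hπ x hx
  | zero => rw [mul_zero]; exact zero_mem _
  | add x y _ _ hx hy => rw [mul_add]; exact add_mem hx hy
  | neg x _ hx => rw [mul_neg]; exact neg_mem hx

/-- `[π]` preserves `relations ⊔ ⟨sector⟩`. [this route] -/
theorem piRep_mul_mem_sup (hπ : PiTimesSector) {y : FormalRep}
    (hy : y ∈ relations ⊔ AddSubgroup.closure ratCubeSet) :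
    of piRep * y ∈ relations ⊔ AddSubgroup.closure ratCubeSet := by
  obtain ⟨ρ, hρ, z, hz, rfl⟩ := AddSubgroup.mem_sup.mp hy
  rw [mul_add]
  exact add_mem (AddSubgroup.mem_sup_left (piRep_mul_mem_relations hρ))
    (piRep_mul_mem_sup_of_mem_closure hπ hz)

/-- Iterated version. [this route] -/
theorem piIter_mem_sup (hπ : PiTimesSector) (K : ℕ) {y : FormalRep}
    (hy : y ∈ relations ⊔ AddSubgroup.closure ratCubeSet) :
    (fun y : FormalRep => of piRep * y)^[K] y ∈ relations ⊔ AddSubgroup.closure ratCubeSet := by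
  induction K with
  | zero => exact hy
  | succ K ih => rw [Function.iterate_succ_apply']; exact piRep_mul_mem_sup hπ ih

/-! ### The fibred substitution move (verbatim from the node, gen 4) -/

/-- `w = snoc (init w) 0 + w_last • (0,…,0,1)`. [folklore] -/
theorem eq_snoc_init_zero_add (m : ℕ) (w : Fin (m + 1) → ℝ) :
    w = Fin.snoc (Fin.init w) (0 : ℝ) + w (Fin.last m) • (Pi.single (Fin.last m) (1 : ℝ) : Fin (m + 1) → ℝ) := by
  ext i
  refine Fin.lastCases ?_ (fun j => ?_) i
  · simp
  · simp [(Fin.castSucc_lt_last j).ne, Fin.init]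

/-- **Fibred substitution along the last coordinate is a change-of-variables move.** Over a
`ℚ`-semialgebraic base `G ⊆ ℝᵐ` with edges `a ≤ b`, let `r` live on the band `{(y,s) | y ∈ G, a y ≤ s ≤ b y}` and
`r'` on the band with edges `a'`, `b'`. Let `ψ` be `ℚ`-semialgebraic on `r.domain`, differentiable at its points,
with `∂ψ/∂s = ψs > 0` there, and `ψ (y, a y) = a' y`, `ψ (y, b y) = b' y`. If
`r.integrand (y, s) = r'.integrand (y, ψ (y, s)) · ψs (y, s)` on `r.domain`, then `[r] − [r']` is an instance of
Kontsevich–Zagier's rule 2) along `Φ (y, s) = (y, ψ (y, s))` (injective and onto the second band fibrewise by strict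
monotonicity and the intermediate value theorem; Jacobian determinant `∂ψ/∂s` by Laplace expansion), hence a
relation. Generalises `KZ.of_sub_of_mem_relations_of_affine` (`ψ = α + β s`). [Kontsevich–Zagier 2001, §1.2, rule 2)]
[folklore] -/
theorem of_sub_of_mem_relations_of_fibreMap {m : ℕ} {G : Set (Fin m → ℝ)}
    {a b a' b' : (Fin m → ℝ) → ℝ} (ψ ψs : (Fin (m + 1) → ℝ) → ℝ)
    (r r' : IntegralRep (m + 1)) (hr : r.domain = KZlog.band G a b)
    (hr' : r'.domain = KZlog.band G a' b') (hab : ∀ y ∈ G, a y ≤ b y)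
    (hψ : IsSemialgebraicFunOn ℚ r.domain ψ)
    (hψd : ∀ z ∈ r.domain, DifferentiableAt ℝ ψ z)
    (hψs : ∀ z ∈ r.domain,
      HasDerivAt (fun t : ℝ => ψ (Fin.snoc (Fin.init z) t)) (ψs z) (z (Fin.last m)))
    (hpos : ∀ z ∈ r.domain, 0 < ψs z)
    (ha : ∀ y ∈ G, ψ (Fin.snoc y (a y)) = a' y) (hb : ∀ y ∈ G, ψ (Fin.snoc y (b y)) = b' y)
    (hint : ∀ z ∈ r.domain, r.integrand z = r'.integrand (Fin.snoc (Fin.init z) (ψ z)) * ψs z) :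
    of r - of r' ∈ relations := by
  have hmemG : ∀ z ∈ r.domain, Fin.init z ∈ G := fun z hz => by
    rw [hr] at hz
    exact hz.1
  have hsnoc_mem : ∀ y ∈ G, ∀ t ∈ Icc (a y) (b y), (Fin.snoc y t : Fin (m + 1) → ℝ) ∈ r.domain := by
    intro y hy t ht
    rw [hr, KZlog.snoc_mem_band]
    exact ⟨hy, ht⟩
  -- the fibre maps
  have hfib_deriv : ∀ y ∈ G, ∀ t ∈ Icc (a y) (b y),
      HasDerivAt (fun s : ℝ => ψ (Fin.snoc y s)) (ψs (Fin.snoc y t)) t := by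
    intro y hy t ht
    have h := hψs _ (hsnoc_mem y hy t ht)
    simpa only [Fin.init_snoc, Fin.snoc_last] using h
  have hfib_cont : ∀ y ∈ G, ContinuousOn (fun s : ℝ => ψ (Fin.snoc y s)) (Icc (a y) (b y)) :=
    fun y hy t ht => (hfib_deriv y hy t ht).continuousAt.continuousWithinAt
  have hfib_mono : ∀ y ∈ G, StrictMonoOn (fun s : ℝ => ψ (Fin.snoc y s)) (Icc (a y) (b y)) := by
    intro y hy
    refine strictMonoOn_of_deriv_pos (convex_Icc _ _) (hfib_cont y hy) fun t ht => ?_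
    rw [interior_Icc] at ht
    have hd := hfib_deriv y hy t (Ioo_subset_Icc_self ht)
    rw [hd.deriv]
    exact hpos _ (hsnoc_mem y hy t (Ioo_subset_Icc_self ht))
  -- the substitution
  set Φ : (Fin (m + 1) → ℝ) → (Fin (m + 1) → ℝ) := fun z => Fin.snoc (Fin.init z) (ψ z) with hΦ
  let Φ' : (Fin (m + 1) → ℝ) → (Fin (m + 1) → ℝ) →L[ℝ] (Fin (m + 1) → ℝ) := fun z =>
    ContinuousLinearMap.pi
      (Fin.lastCases (motive := fun _ => (Fin (m + 1) → ℝ) →L[ℝ] ℝ) (fderiv ℝ ψ z)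
        (fun i => ContinuousLinearMap.proj (Fin.castSucc i)))
  have hΦ' : ∀ z w, Φ' z w = Fin.snoc (Fin.init w) (fderiv ℝ ψ z w) := by
    intro z w
    funext i
    refine Fin.lastCases ?_ (fun j => ?_) i
    · simp [Φ']
    · simp [Φ', Fin.init]
  -- the partial derivative along the last coordinate is `ψs`
  have hlast : ∀ z ∈ r.domain, fderiv ℝ ψ z (Pi.single (Fin.last m) 1) = ψs z := by
    intro z hz
    have hγ : HasDerivAt (fun t : ℝ => (Fin.snoc (Fin.init z) t : Fin (m + 1) → ℝ))
        (Pi.single (Fin.last m) (1 : ℝ)) (z (Fin.last m)) := by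
      rw [hasDerivAt_pi]
      intro i
      refine Fin.lastCases ?_ (fun j => ?_) i
      · simpa using hasDerivAt_id' (z (Fin.last m))
      · simpa [(Fin.castSucc_lt_last j).ne, Fin.init] using hasDerivAt_const (z (Fin.last m)) (z (Fin.castSucc j))
    have h1 : HasDerivAt (fun t : ℝ => ψ (Fin.snoc (Fin.init z) t))
        (fderiv ℝ ψ z (Pi.single (Fin.last m) 1)) (z (Fin.last m)) := by
      have hψz : HasFDerivAt ψ (fderiv ℝ ψ z) (Fin.snoc (Fin.init z) (z (Fin.last m))) := by
        rw [Fin.snoc_init_self]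
        exact (hψd z hz).hasFDerivAt
      exact hψz.comp_hasDerivAt (z (Fin.last m)) hγ
    exact h1.unique (hψs z hz)
  -- determinant
  have hdet : ∀ z ∈ r.domain, (Φ' z).det = ψs z := by
    intro z hz
    let E : (Fin m → ℝ) →ₗ[ℝ] (Fin (m + 1) → ℝ) :=
      LinearMap.pi (Fin.lastCases (motive := fun _ => (Fin m → ℝ) →ₗ[ℝ] ℝ) 0
        (fun i => LinearMap.proj i))
    have hE : ∀ y, E y = Fin.snoc y 0 := by
      intro y
      funext i
      refine Fin.lastCases ?_ (fun j => ?_) i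
      · simp [E]
      · simp [E]
    have h := LinearMap.det_of_snoc_init (Φ' z : (Fin (m + 1) → ℝ) →ₗ[ℝ] (Fin (m + 1) → ℝ))
      LinearMap.id ((fderiv ℝ ψ z : (Fin (m + 1) → ℝ) →ₗ[ℝ] ℝ).comp E)
      (fderiv ℝ ψ z (Pi.single (Fin.last m) 1)) (fun w => by
        rw [ContinuousLinearMap.coe_coe, hΦ', LinearMap.id_apply, LinearMap.comp_apply,
          ContinuousLinearMap.coe_coe, hE]
        congr 1
        conv_lhs => rw [eq_snoc_init_zero_add m w]
        rw [map_add, map_smul, smul_eq_mul, mul_comm])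
    rw [LinearMap.det_id, mul_one, hlast z hz] at h
    exact h
  -- derivative
  have hderiv : ∀ z ∈ r.domain, HasFDerivAt Φ (Φ' z) z := by
    intro z hz
    rw [hasFDerivAt_pi']
    intro i
    refine Fin.lastCases ?_ (fun j => ?_) i
    · have hfun : (fun x => Φ x (Fin.last m)) = ψ := by
        funext x
        simp [hΦ]
      show HasFDerivAt (fun x => Φ x (Fin.last m)) _ z
      rw [hfun]
      refine (hψd z hz).hasFDerivAt.congr_fderiv (ContinuousLinearMap.ext fun w => ?_)
      simp [hΦ']
    · have hfun : (fun x => Φ x (Fin.castSucc j)) = fun x => x (Fin.castSucc j) := by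
        funext x
        simp [hΦ, Fin.init]
      show HasFDerivAt (fun x => Φ x (Fin.castSucc j)) _ z
      rw [hfun]
      refine (hasFDerivAt_apply (Fin.castSucc j) z).congr_fderiv
        (ContinuousLinearMap.ext fun w => ?_)
      simp [hΦ', Fin.init]
  refine changeOfVariablesRel_subset_relations ⟨m + 1, r, r', Φ, Φ', ?_, ?_, ?_, ?_, ?_, rfl⟩
  · -- semialgebraic map
    refine (isSemialgebraicMapOn_iff_forall_holds r.isSemialgebraic_domain).mpr fun i => ?_
    refine Fin.lastCases ?_ (fun j => ?_) i
    · exact hψ.congr fun z _ => by simp [hΦ]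
    · exact (isSemialgebraicFunOn_aeval r.isSemialgebraic_domain
        (MvPolynomial.X (Fin.castSucc j))).congr fun z _ => by simp [hΦ, Fin.init]
  · exact fun z hz => (hderiv z hz).hasFDerivWithinAt
  · -- injective
    intro z₁ hz₁ z₂ hz₂ h
    have hy : Fin.init z₁ = Fin.init z₂ := by
      have := congrArg Fin.init h
      simpa [hΦ] using this
    have hl : ψ z₁ = ψ z₂ := by
      have := congrFun h (Fin.last m)
      simpa [hΦ] using this
    have hyG : Fin.init z₂ ∈ G := hmemG z₂ hz₂
    have ht₁ : z₁ (Fin.last m) ∈ Icc (a (Fin.init z₂)) (b (Fin.init z₂)) := by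
      rw [hr] at hz₁; rw [← hy]; exact hz₁.2
    have ht₂ : z₂ (Fin.last m) ∈ Icc (a (Fin.init z₂)) (b (Fin.init z₂)) := by
      rw [hr] at hz₂; exact hz₂.2
    have hl' : ψ (Fin.snoc (Fin.init z₂) (z₁ (Fin.last m))) = ψ (Fin.snoc (Fin.init z₂) (z₂ (Fin.last m))) := by
      rw [Fin.snoc_init_self]
      conv_lhs => rw [← hy, Fin.snoc_init_self]
      exact hl
    have hs : z₁ (Fin.last m) = z₂ (Fin.last m) := (hfib_mono _ hyG).injOn ht₁ ht₂ hl'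
    rw [← Fin.snoc_init_self z₁, ← Fin.snoc_init_self z₂, hy, hs]
  · -- image
    rw [hr']
    ext w
    simp only [mem_image]
    constructor
    · intro hw
      rw [KZlog.mem_band] at hw
      obtain ⟨hy, hw1, hw2⟩ := hw
      have hab' := hab _ hy
      have hivt := intermediate_value_Icc hab' (hfib_cont _ hy)
      rw [ha _ hy, hb _ hy] at hivt
      obtain ⟨t, ht, hwt⟩ := hivt ⟨hw1, hw2⟩
      have hwt' : ψ (Fin.snoc (Fin.init w) t) = w (Fin.last m) := hwt
      refine ⟨Fin.snoc (Fin.init w) t, hsnoc_mem _ hy t ht, ?_⟩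
      simp only [hΦ, Fin.init_snoc]
      rw [hwt', Fin.snoc_init_self]
    · rintro ⟨z, hz, rfl⟩
      have hy : Fin.init z ∈ G := hmemG z hz
      have ht : z (Fin.last m) ∈ Icc (a (Fin.init z)) (b (Fin.init z)) := by
        rw [hr] at hz; exact hz.2
      have hmono := (hfib_mono _ hy).monotoneOn
      have haz : a (Fin.init z) ∈ Icc (a (Fin.init z)) (b (Fin.init z)) := left_mem_Icc.mpr (hab _ hy)
      have hbz : b (Fin.init z) ∈ Icc (a (Fin.init z)) (b (Fin.init z)) := right_mem_Icc.mpr (hab _ hy)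
      have h1 := hmono haz ht ht.1
      have h2 := hmono ht hbz ht.2
      simp only [ha _ hy, hb _ hy, Fin.snoc_init_self] at h1 h2
      rw [KZlog.mem_band]
      simp only [hΦ, Fin.init_snoc, Fin.snoc_last]
      exact ⟨hy, h1, h2⟩
  · intro z hz
    rw [hint z hz, hdet z hz, abs_of_pos (hpos z hz)]

end Summit.KontsevichZagierPeriods.RootDecompRationalCubeDichotomy.Rung24903
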